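import Literature.Topology.FourManifolds.SmoothIntersectionForms
import Literature.Topology.FourManifolds.SphereSimplyConnected
import Literature.AlgebraicTopology.SingularHomology.OrientationCover
import Literature.AlgebraicTopology.SingularHomology.UniversalCoefficientsFree
import Literature.AlgebraicTopology.SingularHomology.ExcisionMayerVietorisProofs
import HarnessLib

/-!
# Freedman's realisation theorem (`spc4.S05`): the rank-zero case, proved

Companion of `Literature/Topology/FourManifolds/SmoothIntersectionForms.lean` (whose statements
are unchanged). `Literature.Topology.FourManifolds.exists_intersectionForm_equivalent` there is
the named fact vendoring Freedman's realisation theorem (Freedman–Quinn 1990, §10.1, Theorem,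
part (1) "Existence", p. 161; proof pp. 167–168): every nonsingular symmetric bilinear form on a
finitely generated free `ℤ`-module is the intersection form of a closed simply connected
topological 4-manifold. Its printed proof rests on the fact that every homology 3-sphere bounds
a contractible topological 4-manifold (Freedman–Quinn 1990, 9.3C) and on the connected-sum
decomposition theorem (10.3), i.e. on the disc embedding theorem; none of this is in the tree, so
the fact is not discharged here.

This file proves the one case that needs no 4-dimensional topology beyond the tree: the form of
rank `0` is realised by the standard sphere `S⁴ ⊂ ℝ⁵` (Freedman–Quinn 1990, §10.1, p. 161: "`S⁴`
and `S² × S²` have even forms, so are uniquely determined by their forms"; the form of `S⁴` lives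
on `H²(S⁴; ℤ) = 0`). Besides recording the base case, it certifies that the existential package
of the fact's conclusion (`T2Space`, `SecondCountableTopology`, `ChartedSpace ℝ⁴`,
`CompactSpace`, `SimplyConnectedSpace`, a `ℤ`-orientation `HomologicalOrientation ℤ M 4`, all on
one `M : Type`) is simultaneously inhabited.

## Main statements (all proved)

* `Literature.Topology.FourManifolds.subsingleton_singularCohomology_two_sphereFour`:
  `H²(S⁴; ℤ) = 0`, from the tree's `H₁(S⁴; ℤ) = H₂(S⁴; ℤ) = 0`
  (`isZero_singularHomology_sphere_holds`, Hatcher Cor. 2.14) and universal coefficients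
  (`kroneckerPairing_bijective_of_isZero`, Hatcher Thm. 3.2).
* `Literature.Topology.FourManifolds.subsingleton_freeCohomology_two_sphereFour`: hence
  `H²(S⁴; ℤ)/T = 0`.
* `Literature.Topology.FourManifolds.exists_intersectionForm_equivalent_of_subsingleton`: the
  rank-`0` case of `exists_intersectionForm_equivalent` — every bilinear form on a trivial
  `ℤ`-module is the intersection form of `S⁴` (simply connected by
  `simplyConnectedSpace_euclideanSphere`, `ℤ`-oriented by
  `isOrientableOver_int_of_simplyConnectedSpace_holds`).

## Deliberately not here

The general case (size XL: disc embedding theorem, 4-dimensional 2-handlebodies realising a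
unimodular matrix, Mayer–Vietoris/van Kampen for the glued manifold); no new named facts are
introduced (D-0026). No notation is declared: the sphere is written
`Metric.sphere (0 : EuclideanSpace ℝ (Fin (4 + 1))) 1` (Mathlib's charted-space instance is
stated for `Fin (n + 1)`), the form of `(M, μ)` is `intersectionForm two_add_two_eq_four μ`.

Sources: M. H. Freedman, F. Quinn, *Topology of 4-Manifolds*, Princeton Math. Series 39 (1990),
§10.1 (p. 161) and proof of 10.1 (pp. 167–168); A. Hatcher, *Algebraic Topology* (2002),
Cor. 2.14, §3.1 Thm. 3.2, Prop. 1.14, Prop. 3.25.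
-/

open scoped Manifold ContDiff
open LinearMap.BilinForm

noncomputable section

namespace Literature.Topology.FourManifolds

open Literature.AlgebraicTopology.SingularHomology

/-- **`H²(S⁴; ℤ) = 0`** (Hatcher 2002, Cor. 2.14 with §3.1 Thm. 3.2: `H₂(S⁴) = 0` and
`H₁(S⁴) = 0` is free, so `H²(S⁴; ℤ) ≅ Hom(H₂(S⁴), ℤ) = 0`). From the tree's proved
`isZero_singularHomology_sphere_holds` and `kroneckerPairing_bijective_of_isZero`.
[cite: HatcherAT2002, Cor. 2.14 and §3.1 Thm. 3.2] -/
theorem subsingleton_singularCohomology_two_sphereFour :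
    Subsingleton
      (singularCohomology ℤ ℤ (Metric.sphere (0 : EuclideanSpace ℝ (Fin (4 + 1))) 1) 2) := by
  have h1 : CategoryTheory.Limits.IsZero
      (singularHomology ℤ ℤ (Metric.sphere (0 : EuclideanSpace ℝ (Fin (4 + 1))) 1) 1) :=
    isZero_singularHomology_sphere_holds ℤ ℤ (n := 4) (k := 1) one_ne_zero (by decide)
  have h2 : CategoryTheory.Limits.IsZero
      (singularHomology ℤ ℤ (Metric.sphere (0 : EuclideanSpace ℝ (Fin (4 + 1))) 1) 2) :=
    isZero_singularHomology_sphere_holds ℤ ℤ (n := 4) (k := 2) two_ne_zero (by decide)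
  haveI := ModuleCat.subsingleton_of_isZero h2
  exact (kroneckerPairing_bijective_of_isZero ℤ
    (Metric.sphere (0 : EuclideanSpace ℝ (Fin (4 + 1))) 1) 1 h1).1.subsingleton

/-- **`H²(S⁴; ℤ)/T = 0`**: cohomology modulo torsion of `S⁴` in degree `2` is trivial, as a
quotient of `H²(S⁴; ℤ) = 0` (Hatcher 2002, Cor. 2.14). [cite: HatcherAT2002, Cor. 2.14] -/
theorem subsingleton_freeCohomology_two_sphereFour :
    Subsingleton (freeCohomology ℤ (Metric.sphere (0 : EuclideanSpace ℝ (Fin (4 + 1))) 1) 2) := by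
  haveI := subsingleton_singularCohomology_two_sphereFour
  exact (freeCohomology.mk_surjective (R := ℤ)
    (X := Metric.sphere (0 : EuclideanSpace ℝ (Fin (4 + 1))) 1) (k := 2)).subsingleton

/-- **Freedman's realisation theorem, rank-zero case** (Freedman–Quinn 1990, §10.1, Theorem (1)
and p. 161: "`S⁴` and `S² × S²` have even forms, so are uniquely determined by their forms"; the
form of `S⁴` is the zero form on `H²(S⁴; ℤ) = 0`). Every bilinear form `Q` on a trivial
`ℤ`-module is the intersection form of a closed simply connected topological 4-manifold, namely
the standard sphere `S⁴ ⊂ ℝ⁵` with any of its `ℤ`-orientations: both `Q` and `Q_{S⁴}` live on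
zero modules, and the unique linear equivalence `0 ≃ 0` is an isometry. This is the special case
`rank V = 0` of the named fact `exists_intersectionForm_equivalent`, with literally the same
conclusion. [cite: FreedmanQuinn1990, §10.1 Theorem (1), p. 161] -/
theorem exists_intersectionForm_equivalent_of_subsingleton {V : Type} [AddCommGroup V]
    [Module ℤ V] [Subsingleton V] (Q : LinearMap.BilinForm ℤ V) :
    ∃ (M : Type) (_ : TopologicalSpace M) (_ : T2Space M) (_ : SecondCountableTopology M)
      (_ : ChartedSpace (EuclideanSpace ℝ (Fin 4)) M) (_ : CompactSpace M)
      (_ : SimplyConnectedSpace M) (μ : HomologicalOrientation ℤ M 4),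
      (intersectionForm two_add_two_eq_four μ).Equivalent Q := by
  haveI : SimplyConnectedSpace (Metric.sphere (0 : EuclideanSpace ℝ (Fin (4 + 1))) 1) :=
    simplyConnectedSpace_euclideanSphere (n := 4) (by norm_num)
  obtain ⟨μ⟩ := isOrientableOver_int_of_simplyConnectedSpace_holds
    (Metric.sphere (0 : EuclideanSpace ℝ (Fin (4 + 1))) 1) (n := 4)
  haveI := subsingleton_freeCohomology_two_sphereFour
  have hQ : ∀ a b : V, Q a b = 0 := fun a b => by
    rw [Subsingleton.elim a 0, map_zero, LinearMap.zero_apply]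
  have hS : ∀ a b : freeCohomology ℤ (Metric.sphere (0 : EuclideanSpace ℝ (Fin (4 + 1))) 1) 2,
      intersectionForm two_add_two_eq_four μ a b = 0 := fun a b => by
    rw [Subsingleton.elim a 0, map_zero, LinearMap.zero_apply]
  exact ⟨Metric.sphere (0 : EuclideanSpace ℝ (Fin (4 + 1))) 1, inferInstance, inferInstance,
    inferInstance, inferInstance, inferInstance, inferInstance, μ,
    ⟨{ toLinearEquiv := LinearEquiv.ofSubsingleton _ _
       map_app' := fun x y => (hQ _ _).trans (hS x y).symm }⟩⟩

end Literature.Topology.FourManifolds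

end
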